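import Literature.Analysis.FunctionSpaces.TorusFluidGlueProofs
import Literature.Analysis.FunctionSpaces.TorusSpaceTime
import Literature.Analysis.FluidPDE.WeakSolution
import Literature.Analysis.FluidPDE.DuchonRobertInviscidLimit
import HarnessLib

/-!
# Classical Navier–Stokes solutions on an open time strip: weak formulation and the tested
local energy equality

Analysis/FluidPDE support file (theorem-only; serves the De Rosa–Isett intermittency barrier
`Literature/Barriers/AnomalousDissipation/IntermittentDissipation`, whose families of smooth
solutions live on the *open* strip `T^d × (0,T)` — nothing is assumed at `t = 0` — while the
tree's "classical ⇒ weak" (`Torus.IsClassicalNSSolutionOn.isWeakNSSolutionOn_holds`) and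
"no defect for smooth fields" (`Torus.hasDuchonRobertDefect_zero_of_smooth`) want smoothness on
the closed `[0,T]`).

For a classical solution `(u, p)` of the unforced Navier–Stokes system with viscosity `ν` on
`T^d × (0,T)` (`Torus.IsClassicalNSSolutionOn (Ioo 0 T) ν 0 u p`):

* `Torus.IsClassicalNSSolutionOn.isWeakNSSolutionOn_of_Ioo` — if moreover
  `u ∈ L²((0,T) × T^d)`, then `u` is a weak (pressure-free) solution on `T^d × (0,T)`
  (`Torus.IsWeakNSSolutionOn T ν u`): the test fields are supported in a compact
  `[ε, T'] ⊂ (0,T)`, where the printed integration by parts applies verbatim.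
* `Torus.IsClassicalNSSolutionOn.energyEq_of_isDistributional` — **the tested local energy
  equality with any distributional pressure**: if `q` is any pressure making `(u, q)` a
  distributional solution on `T^d × (0,T)` (`Torus.IsDistributionalNSSolutionOn T ν 0 u q`, e.g.
  the Calderón–Zygmund pressure of `Torus.exists_pressure_of_tendsto_L3`), then for every smooth
  `ψ` compactly supported in `(0,T) × T^d`
  `∫∫ [½|u|²∂ₜψ + (½|u|² + q)⟪u,∇ψ⟫ + ½ν|u|²Δψ] = ν ∫∫ ψ ∑ᵢ‖∂ᵢu‖²`
  (Duchon–Robert 2000, (6) with `D(u) = 0` for regular `u`; Caffarelli–Kohn–Nirenberg 1982,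
  (2.5) with equality). Proof: test the distributional momentum equation of `(u, q)` with the
  smooth field `Ψ = ψu` (a legitimate test field: `u` is smooth where `ψ ≠ 0`) and integrate by
  parts on the torus — `∫⟪u,(u·∇)(ψu)⟫ = ½∫|u|²⟪u,∇ψ⟫`, `∫⟪u,Δ(ψu)⟫ = ½∫|u|²Δψ - ∫ψ∑‖∂ᵢu‖²`,
  `q div(ψu) = q⟪u,∇ψ⟫`, and in time `⟪u,∂ₜ(ψu)⟫ = ∂ₜ(½ψ|u|²) + ½|u|²∂ₜψ` with
  `∫∫ ∂ₜ(½ψ|u|²) = 0`. No uniqueness theory for the pressure is needed (the ambiguity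
  `q ↦ q + c(t)` is invisible because `div u = 0` exactly).

## References

* J. Duchon, R. Robert, Nonlinearity 13 (2000), Prop. 1 and (6), (10) (local energy equation of
  regular / weak solutions). [DuchonRobert2000]
* L. Caffarelli, R. Kohn, L. Nirenberg, CPAM 35 (1982), §2, (2.5). [CaffarelliKohnNirenberg1982]
* R. Temam, *Navier–Stokes Equations* (1984), Ch. II §1.2, Lemma 1.3 (the trilinear form).
-/

open MeasureTheory Set Filter Function
open _root_.Topology
open scoped ENNReal NNReal InnerProductSpace

noncomputable section

namespace Literature.Analysis.FluidPDE.Torus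

variable {d : Type*} [Fintype d] [DecidableEq d]

/-! ## Slice identities on the torus for the test field `Ψ = φ u` -/

section Slice

variable {u : UnitAddTorus d → EuclideanSpace ℝ d} {φ : UnitAddTorus d → ℝ}

/-- `∫ ⟪u, (u·∇)(φu)⟫ = ½ ∫ |u|² ⟪u, ∇φ⟫` for smooth divergence-free `u` and smooth `φ`
(Leibniz `(u·∇)(φu) = (u·∇φ)u + φ(u·∇)u` and antisymmetry of the trilinear form,
`∫ φ⟪u,(u·∇)u⟫ = -½∫(u·∇φ)|u|²`; Temam, Ch. II Lemma 1.3). [folklore] -/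
theorem integral_inner_convect_smul_self (hu : FunctionSpaces.Torus.IsSmooth u) (hdiv : FunctionSpaces.Torus.IsDivFree u) (hφ : FunctionSpaces.Torus.IsSmooth φ) :
    ∫ x, ⟪u x, FunctionSpaces.Torus.convect u (fun y => φ y • u y) x⟫_ℝ =
      2⁻¹ * ∫ x, ‖u x‖ ^ 2 * ⟪u x, FunctionSpaces.Torus.gradient φ x⟫_ℝ := by
  have hu1 : FunctionSpaces.Torus.IsContDiff 1 u := hu.isContDiff (by simp)
  have hφ1 : FunctionSpaces.Torus.IsContDiff 1 φ := hφ.isContDiff (by simp)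
  have hΦ : FunctionSpaces.Torus.IsSmooth (fun y => φ y • u y) := hφ.smul' hu
  -- pointwise Leibniz
  have hpt : ∀ x, ⟪u x, FunctionSpaces.Torus.convect u (fun y => φ y • u y) x⟫_ℝ =
      ‖u x‖ ^ 2 * ⟪u x, FunctionSpaces.Torus.gradient φ x⟫_ℝ +
        φ x * ⟪u x, FunctionSpaces.Torus.convect u u x⟫_ℝ := by
    intro x
    simp only [FunctionSpaces.Torus.convect]
    rw [FunctionSpaces.Torus.fderiv_smul_apply hφ1 hu1, inner_add_right, inner_smul_right,
      inner_smul_right, real_inner_self_eq_norm_sq,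
      real_inner_comm (FunctionSpaces.Torus.gradient φ x) (u x),
      FunctionSpaces.Torus.inner_gradient_left]
    ring
  have hsB : FunctionSpaces.Torus.IsSmooth
      (fun x => ‖u x‖ ^ 2 * ⟪u x, FunctionSpaces.Torus.gradient φ x⟫_ℝ) :=
    hu.norm_sq.mul (hu.inner hφ.gradient)
  have hsA : FunctionSpaces.Torus.IsSmooth
      (fun x => φ x * ⟪u x, FunctionSpaces.Torus.convect u u x⟫_ℝ) :=
    hφ.mul (hu.inner (hu.convect hu))
  have iB : Integrable (fun x => ‖u x‖ ^ 2 * ⟪u x, FunctionSpaces.Torus.gradient φ x⟫_ℝ) volume :=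
    hsB.integrable
  have iA : Integrable (fun x => φ x * ⟪u x, FunctionSpaces.Torus.convect u u x⟫_ℝ) volume :=
    hsA.integrable
  -- antisymmetry: `∫ ⟪(u·∇)u, φu⟫ = -∫ ⟪u, (u·∇)(φu)⟫`
  have hanti := FunctionSpaces.Torus.integral_inner_convect_eq_neg hu hdiv hu hΦ
  have hleft : ∫ x, ⟪FunctionSpaces.Torus.convect u u x, φ x • u x⟫_ℝ =
      ∫ x, φ x * ⟪u x, FunctionSpaces.Torus.convect u u x⟫_ℝ :=
    integral_congr_ae (ae_of_all _ fun x => by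
      show ⟪FunctionSpaces.Torus.convect u u x, φ x • u x⟫_ℝ = φ x * ⟪u x, FunctionSpaces.Torus.convect u u x⟫_ℝ
      rw [inner_smul_right, real_inner_comm])
  simp_rw [hpt] at hanti ⊢
  rw [integral_add iB iA] at hanti ⊢
  rw [hleft] at hanti
  linarith

/-- `∫ ⟪Δa, w⟫ = -∑ᵢ ∫ ⟪∂ᵢa, ∂ᵢw⟫` for smooth fields on the torus (Green's first identity,
Evans App. C.2 Thm. 3 (i), empty boundary). [folklore] -/
theorem integral_inner_laplacian_eq_neg_sum {G : Type*} [NormedAddCommGroup G] [InnerProductSpace ℝ G]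
    {a w : UnitAddTorus d → G} (ha : FunctionSpaces.Torus.IsSmooth a) (hw : FunctionSpaces.Torus.IsSmooth w) :
    ∫ x, ⟪FunctionSpaces.Torus.laplacian a x, w x⟫_ℝ = -∑ i, ∫ x, ⟪FunctionSpaces.Torus.partialDeriv i a x, FunctionSpaces.Torus.partialDeriv i w x⟫_ℝ := by
  simp_rw [FunctionSpaces.Torus.laplacian_eq_sum_partialDeriv_partialDeriv ha, sum_inner]
  rw [integral_finsetSum _ fun i _ => (((ha.partialDeriv i).partialDeriv i).inner hw).integrable,
    ← Finset.sum_neg_distrib]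
  exact Finset.sum_congr rfl fun i _ => FunctionSpaces.Torus.integral_inner_partialDeriv_eq_neg (ha.partialDeriv i) hw i

/-- `∫ ⟪u, Δ(φu)⟫ = ½ ∫ |u|² Δφ - ∫ φ ∑ᵢ ‖∂ᵢu‖²` for smooth `u`, `φ` on the torus (Green's
identities: `∫⟪u, Δ(φu)⟫ = ∫⟪Δu, φu⟫ = -∑∫⟪∂ᵢu, ∂ᵢφ u + φ∂ᵢu⟫` and
`∑∫ ∂ᵢφ ⟪∂ᵢu, u⟫ = ½∑∫ ∂ᵢφ ∂ᵢ|u|² = -½∫|u|²Δφ`). [folklore] -/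
theorem integral_inner_laplacian_smul_self (hu : FunctionSpaces.Torus.IsSmooth u) (hφ : FunctionSpaces.Torus.IsSmooth φ) :
    ∫ x, ⟪u x, FunctionSpaces.Torus.laplacian (fun y => φ y • u y) x⟫_ℝ =
      2⁻¹ * (∫ x, ‖u x‖ ^ 2 * FunctionSpaces.Torus.laplacian φ x) -
        ∫ x, φ x * ∑ i, ‖FunctionSpaces.Torus.partialDeriv i u x‖ ^ 2 := by
  have hu1 : FunctionSpaces.Torus.IsContDiff 1 u := hu.isContDiff (by simp)
  have hφ1 : FunctionSpaces.Torus.IsContDiff 1 φ := hφ.isContDiff (by simp)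
  have hΦ : FunctionSpaces.Torus.IsSmooth (fun y => φ y • u y) := hφ.smul' hu
  -- move the Laplacian onto `u`
  have h1 : ∫ x, ⟪u x, FunctionSpaces.Torus.laplacian (fun y => φ y • u y) x⟫_ℝ =
      ∫ x, ⟪FunctionSpaces.Torus.laplacian u x, φ x • u x⟫_ℝ := by
    rw [← FunctionSpaces.Torus.integral_inner_laplacian_comm hu hΦ]
  rw [h1, integral_inner_laplacian_eq_neg_sum hu hΦ]
  -- the two pieces of `⟪∂ᵢu, ∂ᵢ(φu)⟫`
  have hpt : ∀ i x, ⟪FunctionSpaces.Torus.partialDeriv i u x, FunctionSpaces.Torus.partialDeriv i (fun y => φ y • u y) x⟫_ℝ =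
      2⁻¹ * (FunctionSpaces.Torus.partialDeriv i (fun y => ‖u y‖ ^ 2) x * FunctionSpaces.Torus.partialDeriv i φ x) +
        φ x * ‖FunctionSpaces.Torus.partialDeriv i u x‖ ^ 2 := by
    intro i x
    have hn : (fun y => ‖u y‖ ^ 2) = fun y => ⟪u y, u y⟫_ℝ :=
      funext fun y => (real_inner_self_eq_norm_sq _).symm
    rw [FunctionSpaces.Torus.partialDeriv_smul hφ1 hu1, inner_add_right, inner_smul_right, inner_smul_right,
      real_inner_self_eq_norm_sq, hn, FunctionSpaces.Torus.partialDeriv_inner hu1 hu1, real_inner_comm (u x)]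
    ring
  have hs : ∀ i, FunctionSpaces.Torus.IsSmooth (fun x => 2⁻¹ *
      (FunctionSpaces.Torus.partialDeriv i (fun y => ‖u y‖ ^ 2) x * FunctionSpaces.Torus.partialDeriv i φ x)) :=
    fun i => contDiff_const.mul ((hu.norm_sq.partialDeriv i).mul (hφ.partialDeriv i))
  have hp : ∀ i, FunctionSpaces.Torus.IsSmooth (fun x => φ x * ‖FunctionSpaces.Torus.partialDeriv i u x‖ ^ 2) := fun i =>
    hφ.mul (hu.partialDeriv i).norm_sq
  have hsum : ∑ i, ∫ x, ⟪FunctionSpaces.Torus.partialDeriv i u x, FunctionSpaces.Torus.partialDeriv i (fun y => φ y • u y) x⟫_ℝ =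
      2⁻¹ * (∑ i, ∫ x, FunctionSpaces.Torus.partialDeriv i (fun y => ‖u y‖ ^ 2) x *
          FunctionSpaces.Torus.partialDeriv i φ x) +
        ∫ x, φ x * ∑ i, ‖FunctionSpaces.Torus.partialDeriv i u x‖ ^ 2 := by
    have hR : ∫ x, φ x * ∑ i, ‖FunctionSpaces.Torus.partialDeriv i u x‖ ^ 2 =
        ∑ i, ∫ x, φ x * ‖FunctionSpaces.Torus.partialDeriv i u x‖ ^ 2 := by
      rw [← integral_finsetSum _ fun i _ => (hp i).integrable]
      exact integral_congr_ae (ae_of_all _ fun x => Finset.mul_sum _ _ _)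
    rw [hR, Finset.mul_sum, ← Finset.sum_add_distrib]
    refine Finset.sum_congr rfl fun i _ => ?_
    simp_rw [hpt i]
    rw [integral_add (hs i).integrable (hp i).integrable, integral_const_mul]
  have hgreen := FunctionSpaces.Torus.integral_mul_laplacian_eq_neg_sum hu.norm_sq hφ
  rw [hsum, hgreen]
  ring

/-- `div (φu) = ⟪u, ∇φ⟫ + φ div u` for `C¹` fields on the torus. [folklore] -/
theorem divergence_smul (hφ : FunctionSpaces.Torus.IsContDiff 1 φ) (hu : FunctionSpaces.Torus.IsContDiff 1 u) (x : UnitAddTorus d) :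
    FunctionSpaces.Torus.divergence (fun y => φ y • u y) x = ⟪u x, FunctionSpaces.Torus.gradient φ x⟫_ℝ + φ x * FunctionSpaces.Torus.divergence u x := by
  have h1 : ∀ i, FunctionSpaces.Torus.IsContDiff 1 (fun y => u y i) := fun i =>
    (EuclideanSpace.proj i : EuclideanSpace ℝ d →L[ℝ] ℝ).contDiff.comp hu
  have hcomp : ∀ i, (fun y => (φ y • u y) i) = fun y => φ y * u y i := fun i => by
    funext y; simp
  simp only [FunctionSpaces.Torus.divergence, hcomp]
  simp_rw [FunctionSpaces.Torus.partialDeriv_mul hφ (h1 _), Finset.sum_add_distrib, ← Finset.mul_sum]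
  rw [real_inner_comm, FunctionSpaces.Torus.inner_gradient_left, FunctionSpaces.Torus.fderiv_apply_eq_sum_partialDeriv hφ, add_comm]
  simp [smul_eq_mul, mul_comm]

end Slice

/-! ## Test functions supported in `(0,T)`: cut-off times and vanishing derivatives -/

section TestSupport

variable {F : Type*} [NormedAddCommGroup F] [NormedSpace ℝ F] {T : ℝ}

omit [DecidableEq d] in
/-- A test field supported in `(0,T)`, `T > 0`, vanishes for `t ≤ a` and for `t ≥ b`, for some
`0 < a ≤ b < T`. [folklore] -/
theorem exists_support_Icc {ψ : ℝ → UnitAddTorus d → F}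
    (hψ : FunctionSpaces.Torus.IsSpaceTimeTestIoo T ψ) (hT : 0 < T) :
    ∃ a b : ℝ, 0 < a ∧ a ≤ b ∧ b < T ∧ (∀ t ≤ a, ψ t = 0) ∧ ∀ t, b ≤ t → ψ t = 0 := by
  obtain ⟨⟨-, T', hT'T, hT'⟩, ε, hε, hε0⟩ := hψ
  refine ⟨min ε (T / 2), max T' (T / 2), lt_min hε (by linarith), ?_, max_lt hT'T (by linarith),
    fun t ht => hε0 t (ht.trans (min_le_left _ _)), fun t ht => hT' t ((le_max_left _ _).trans ht)⟩
  exact (min_le_right _ _).trans (le_max_right _ _)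

omit [Fintype d] [DecidableEq d] in
/-- The time derivative of a field vanishing for all `τ ≤ a` vanishes for `t < a`. [folklore] -/
theorem timeDeriv_eq_zero_of_lt {ψ : ℝ → UnitAddTorus d → F} {a t : ℝ} (h : ∀ τ ≤ a, ψ τ = 0)
    (ht : t < a) (x : UnitAddTorus d) : FunctionSpaces.Torus.timeDeriv ψ t x = 0 := by
  have he : (fun τ => ψ τ x) =ᶠ[𝓝 t] fun _ => (0 : F) := by
    filter_upwards [Iio_mem_nhds ht] with τ hτ
    rw [h τ (le_of_lt hτ), Pi.zero_apply]
  change deriv (fun τ => ψ τ x) t = 0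
  rw [he.deriv_eq, deriv_const]

omit [Fintype d] [DecidableEq d] in
/-- The time derivative of a field vanishing for all `τ ≥ b` vanishes for `t > b`. [folklore] -/
theorem timeDeriv_eq_zero_of_gt {ψ : ℝ → UnitAddTorus d → F} {b t : ℝ} (h : ∀ τ, b ≤ τ → ψ τ = 0)
    (ht : b < t) (x : UnitAddTorus d) : FunctionSpaces.Torus.timeDeriv ψ t x = 0 := by
  have he : (fun τ => ψ τ x) =ᶠ[𝓝 t] fun _ => (0 : F) := by
    filter_upwards [Ioi_mem_nhds ht] with τ hτ
    rw [h τ (le_of_lt hτ), Pi.zero_apply]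
  change deriv (fun τ => ψ τ x) t = 0
  rw [he.deriv_eq, deriv_const]

omit [Fintype d] [DecidableEq d] in
/-- The one-sided time derivative of a field vanishing identically near `t` vanishes at `t`. [folklore] -/
theorem timeDerivWithin_eq_zero_of_eventuallyEq {S : Set ℝ} {g : ℝ → UnitAddTorus d → F} {t : ℝ}
    (x : UnitAddTorus d) (h : (fun τ => g τ x) =ᶠ[𝓝 t] fun _ => (0 : F)) :
    FunctionSpaces.Torus.timeDerivWithin S g t x = 0 := by
  change derivWithin (fun τ => g τ x) S t = 0
  rw [h.derivWithin_eq_of_nhds]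
  simp

omit [DecidableEq d] in
/-- The torus gradient of the zero function vanishes. [folklore] -/
theorem torusGradient_zero (x : UnitAddTorus d) :
    FunctionSpaces.Torus.gradient (0 : UnitAddTorus d → ℝ) x = 0 := by
  unfold FunctionSpaces.Torus.gradient FunctionSpaces.Torus.liftAt
  simp [gradient_fun_const]

omit [DecidableEq d] in
/-- The torus Laplacian of the zero function vanishes. [folklore] -/
theorem torusLaplacian_zero (x : UnitAddTorus d) :
    FunctionSpaces.Torus.laplacian (0 : UnitAddTorus d → F) x = 0 := by
  unfold FunctionSpaces.Torus.laplacian FunctionSpaces.Torus.liftAt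
  simp

omit [DecidableEq d] in
/-- **`ψu` is a test field.** If `u` is jointly smooth on the open strip `(0,T) × T^d` and `ψ` is
a scalar test function supported in `(0,T)`, then `Ψ(t,x) = ψ(t,x) u(t,x)` (extended by zero) is
a smooth vector test field supported in `(0,T)`: where `ψ ≠ 0` the field `u` is smooth, and near
every point with `t ∉ (0,T)` the product vanishes identically. [folklore] -/
theorem isSpaceTimeTestIoo_smul_of_isSmoothSpaceTimeOn {u : ℝ → UnitAddTorus d → F} {ψ : ℝ → UnitAddTorus d → ℝ}
    (hu : FunctionSpaces.Torus.IsSmoothSpaceTimeOn (Ioo 0 T) u)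
    (hψ : FunctionSpaces.Torus.IsSpaceTimeTestIoo T ψ) :
    FunctionSpaces.Torus.IsSpaceTimeTestIoo T (fun t x => ψ t x • u t x) := by
  obtain ⟨⟨hψs, T', hT'T, hT'⟩, ε, hε, hε0⟩ := hψ
  refine ⟨⟨?_, T', hT'T, fun t ht => ?_⟩, ε, hε, fun t ht => ?_⟩
  · rw [contDiff_iff_contDiffAt]
    rintro ⟨t, y⟩
    by_cases htI : t ∈ Ioo 0 T
    · have hopen : IsOpen (Ioo 0 T ×ˢ (univ : Set (EuclideanSpace ℝ d))) :=
        isOpen_Ioo.prod isOpen_univ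
      have huAt := hu.contDiffAt (x := (t, y)) (hopen.mem_nhds (mk_mem_prod htI (mem_univ y)))
      exact (hψs.contDiffAt (x := (t, y))).smul huAt
    · -- near `(t, y)` the product vanishes identically
      have hzero : (FunctionSpaces.Torus.stLift fun t x => ψ t x • u t x) =ᶠ[𝓝 (t, y)]
          fun _ => (0 : F) := by
        rcases not_and_or.1 (fun h => htI ⟨h.1, h.2⟩) with h0 | hT
        · have hmem : {z : ℝ × EuclideanSpace ℝ d | z.1 < ε} ∈ 𝓝 (t, y) :=
            (isOpen_lt continuous_fst continuous_const).mem_nhds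
              (show t < ε by linarith [not_lt.1 h0])
          filter_upwards [hmem] with z hz
          simp [FunctionSpaces.Torus.stLift, hε0 z.1 (le_of_lt hz)]
        · have hmem : {z : ℝ × EuclideanSpace ℝ d | T' < z.1} ∈ 𝓝 (t, y) :=
            (isOpen_lt continuous_const continuous_fst).mem_nhds
              (show T' < t by linarith [not_lt.1 hT])
          filter_upwards [hmem] with z hz
          simp [FunctionSpaces.Torus.stLift, hT' z.1 (le_of_lt hz)]
      exact (contDiffAt_const (c := (0 : F))).congr_of_eventuallyEq hzero
  · funext x
    simp [hT' t ht]
  · funext x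
    simp [hε0 t ht]

end TestSupport

/-! ## Classical solutions on the open strip are weak solutions -/

section Weak

variable {T ν : ℝ} {u : ℝ → UnitAddTorus d → EuclideanSpace ℝ d} {p : ℝ → UnitAddTorus d → ℝ}

/-- **Classical solutions on the open strip are weak solutions.** A classical solution of the
unforced Navier–Stokes system on `T^d × (0,T)` that is square integrable on `(0,T) × T^d` is a
weak (pressure-free) solution on `T^d × (0,T)` (De Lellis–Székelyhidi 2009, §1; the printed
integration by parts of `Torus.IsClassicalNSSolutionOn.isWeakNSSolutionOn_holds`, run on a
compact `[a,b] ⊂ (0,T)` carrying the support of the test field). Square integrability up to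
`t = 0` is a genuine hypothesis here (nothing is assumed at `t = 0`). [cite: LellisSzekelyhidi2009, §1 eq. (2)] -/
theorem _root_.Literature.Analysis.FunctionSpaces.Torus.IsClassicalNSSolutionOn.isWeakNSSolutionOn_of_Ioo
    (h : FunctionSpaces.Torus.IsClassicalNSSolutionOn (Ioo 0 T) ν 0 u p)
    (hL2 : ∫⁻ t in Ioo 0 T, ∫⁻ x, ‖u t x‖ₑ ^ 2 < ∞) :
    FunctionSpaces.Torus.IsWeakNSSolutionOn T ν u := by
  have hu : FunctionSpaces.Torus.IsSmoothSpaceTimeOn (Ioo 0 T) u := h.smooth_velocity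
  refine ⟨hu.aestronglyMeasurable_stLift measurableSet_Ioo Subset.rfl, hL2, ?_, ?_⟩
  · refine (ae_restrict_iff' measurableSet_Ioo).2 (ae_of_all _ fun t ht => ?_)
    exact (h.divFree t ht).isWeaklyDivFree_holds (hu.isSmooth_slice ht)
  intro ψ hψ hψdiv
  rcases le_or_gt T 0 with hT | hT
  · rw [Ioo_eq_empty (not_lt.2 hT), Measure.restrict_empty, integral_zero_measure]
  obtain ⟨a, b, ha, hab, hbT, hψa, hψb⟩ := exists_support_Icc hψ hT
  obtain ⟨⟨hψs, -, -, -⟩, -⟩ := id hψ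
  set S : Set ℝ := Ioo 0 T with hS_def
  have hU : UniqueDiffOn ℝ S := uniqueDiffOn_Ioo 0 T
  have hIS : Icc a b ⊆ S := fun t ht => ⟨ha.trans_le ht.1, ht.2.trans_lt hbT⟩
  have hψS : FunctionSpaces.Torus.IsSmoothSpaceTimeOn S ψ := hψs.contDiffOn
  have hg : FunctionSpaces.Torus.IsSmoothSpaceTimeOn S (fun t x => ⟪u t x, ψ t x⟫_ℝ) := hu.inner hψS
  set E : ℝ → ℝ := fun t => ∫ x, ⟪u t x, ψ t x⟫_ℝ with hE_def
  set E' : ℝ → ℝ := fun t =>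
    ∫ x, FunctionSpaces.Torus.timeDerivWithin S (fun t x => ⟪u t x, ψ t x⟫_ℝ) t x with hE'_def
  have hE : ∀ t ∈ S, HasDerivWithinAt E (E' t) S t := fun t ht =>
    hg.hasDerivWithinAt_integral (convex_Ioo 0 T) ht
  have hE'cont : ContinuousOn E' S := hg.continuousOn_integral_timeDerivWithin hU
  -- `E(a) = E(b) = 0` and `∫ₐᵇ E' = 0`
  have hEa : E a = 0 := by simp only [hE_def, hψa a le_rfl, Pi.zero_apply, inner_zero_right, integral_zero]
  have hEb : E b = 0 := by simp only [hE_def, hψb b le_rfl, Pi.zero_apply, inner_zero_right, integral_zero]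
  have hFTC : ∫ t in Icc a b, E' t = 0 := by
    rw [integral_Icc_eq_integral_Ioc, ← intervalIntegral.integral_of_le hab,
      intervalIntegral.integral_eq_sub_of_hasDerivAt_of_le hab
        (fun t ht => ((hE t (hIS ht)).continuousWithinAt).mono hIS)
        (fun t ht => (hE t (hIS (Ioo_subset_Icc_self ht))).hasDerivAt
          (mem_of_superset (Icc_mem_nhds ht.1 ht.2) hIS))
        ((hE'cont.mono ((uIcc_of_le hab).subset.trans hIS)).intervalIntegrable),
      hEb, hEa, sub_zero]
  -- `E'` vanishes on `S \ [a, b]`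
  have hE'zero : ∀ t ∈ S \ Icc a b, E' t = 0 := by
    intro t ht
    have hev : ∀ x, (fun τ => ⟪u τ x, ψ τ x⟫_ℝ) =ᶠ[𝓝 t] fun _ => (0 : ℝ) := by
      intro x
      rcases not_and_or.1 (fun h => ht.2 ⟨h.1, h.2⟩) with h1 | h2
      · filter_upwards [Iio_mem_nhds (not_le.1 h1)] with τ hτ
        rw [hψa τ hτ.le, Pi.zero_apply, inner_zero_right]
      · filter_upwards [Ioi_mem_nhds (not_le.1 h2)] with τ hτ
        rw [hψb τ hτ.le, Pi.zero_apply, inner_zero_right]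
    simp only [hE'_def]
    rw [show (fun x => FunctionSpaces.Torus.timeDerivWithin S (fun t x => ⟪u t x, ψ t x⟫_ℝ) t x) =
        fun _ => (0 : ℝ) from funext fun x => timeDerivWithin_eq_zero_of_eventuallyEq x (hev x),
      integral_zero]
  have hInt : ∫ t in S, E' t = 0 := by
    rw [setIntegral_eq_of_subset_of_forall_sdiff_eq_zero measurableSet_Ioo hIS hE'zero, hFTC]
  -- the weak integrand equals `E'` on `S`
  refine Eq.trans (setIntegral_congr_fun measurableSet_Ioo fun t ht => ?_) hInt
  have hut : FunctionSpaces.Torus.IsSmooth (u t) := hu.isSmooth_slice ht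
  have hpt : FunctionSpaces.Torus.IsSmooth (p t) := h.smooth_pressure.isSmooth_slice ht
  have hψt : FunctionSpaces.Torus.IsSmooth (ψ t) := hψS.isSmooth_slice ht
  have hψ't : FunctionSpaces.Torus.IsSmooth (FunctionSpaces.Torus.timeDeriv ψ t) :=
    hψ.1.timeDeriv.isSmooth_slice t
  have hS_nhds : S ∈ 𝓝 t := isOpen_Ioo.mem_nhds ht
  have hslice : ∀ x, FunctionSpaces.Torus.timeDerivWithin S (fun t x => ⟪u t x, ψ t x⟫_ℝ) t x =
      ⟪u t x, FunctionSpaces.Torus.timeDeriv ψ t x⟫_ℝ +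
        ⟪ν • FunctionSpaces.Torus.laplacian (u t) x - FunctionSpaces.Torus.gradient (p t) x -
          FunctionSpaces.Torus.convect (u t) (u t) x, ψ t x⟫_ℝ := by
    intro x
    have h1 : HasDerivWithinAt (fun τ => u τ x) (FunctionSpaces.Torus.timeDerivWithin S u t x) S t :=
      hu.hasDerivWithinAt_slice ht x
    have h2 : HasDerivWithinAt (fun τ => ψ τ x) (FunctionSpaces.Torus.timeDeriv ψ t x) S t := by
      obtain ⟨y, rfl⟩ := FunctionSpaces.Torus.proj_surjective x
      have hd : Differentiable ℝ (fun τ : ℝ => FunctionSpaces.Torus.stLift ψ (τ, y)) :=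
        (hψs.differentiable (by simp)).comp (differentiable_id.prodMk (differentiable_const y))
      exact (hd t).hasDerivAt.hasDerivWithinAt
    have h12 := (h1.inner ℝ h2).derivWithin (hU t ht)
    have hm := h.momentum t ht x
    simp only [Pi.zero_apply, add_zero] at hm
    have h3 : FunctionSpaces.Torus.timeDerivWithin S u t x =
        ν • FunctionSpaces.Torus.laplacian (u t) x - FunctionSpaces.Torus.gradient (p t) x -
          FunctionSpaces.Torus.convect (u t) (u t) x := by
      rw [eq_sub_iff_add_eq, hm]
    rw [FunctionSpaces.Torus.timeDerivWithin, h12, h3]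
  have i1 : Integrable (fun x => ⟪u t x, FunctionSpaces.Torus.timeDeriv ψ t x⟫_ℝ) volume :=
    (hut.inner hψ't).integrable
  have i2 : Integrable (fun x => ⟪u t x, FunctionSpaces.Torus.convect (u t) (ψ t) x⟫_ℝ) volume :=
    (hut.inner (hut.convect hψt)).integrable
  have i12 : Integrable (fun x => ⟪u t x, FunctionSpaces.Torus.timeDeriv ψ t x⟫_ℝ +
      ⟪u t x, FunctionSpaces.Torus.convect (u t) (ψ t) x⟫_ℝ) volume := i1.add i2
  have i3 : Integrable (fun x => ν * ⟪u t x, FunctionSpaces.Torus.laplacian (ψ t) x⟫_ℝ) volume :=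
    ((hut.inner hψt.laplacian).integrable).const_mul ν
  have iL : Integrable (fun x => ⟪ν • FunctionSpaces.Torus.laplacian (u t) x, ψ t x⟫_ℝ) volume :=
    ((hut.laplacian.smul ν).inner hψt).integrable
  have iG : Integrable (fun x => ⟪FunctionSpaces.Torus.gradient (p t) x, ψ t x⟫_ℝ) volume :=
    (hpt.gradient.inner hψt).integrable
  have iC : Integrable (fun x => ⟪FunctionSpaces.Torus.convect (u t) (u t) x, ψ t x⟫_ℝ) volume :=
    ((hut.convect hut).inner hψt).integrable
  have iLG : Integrable (fun x => ⟪ν • FunctionSpaces.Torus.laplacian (u t) x, ψ t x⟫_ℝ -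
      ⟪FunctionSpaces.Torus.gradient (p t) x, ψ t x⟫_ℝ) volume := iL.sub iG
  have iLGC : Integrable (fun x => ⟪ν • FunctionSpaces.Torus.laplacian (u t) x, ψ t x⟫_ℝ -
      ⟪FunctionSpaces.Torus.gradient (p t) x, ψ t x⟫_ℝ -
        ⟪FunctionSpaces.Torus.convect (u t) (u t) x, ψ t x⟫_ℝ) volume := iLG.sub iC
  have hlap : ∫ x, ⟪ν • FunctionSpaces.Torus.laplacian (u t) x, ψ t x⟫_ℝ =
      ∫ x, ν * ⟪u t x, FunctionSpaces.Torus.laplacian (ψ t) x⟫_ℝ := by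
    simp_rw [real_inner_smul_left, integral_const_mul]
    rw [FunctionSpaces.Torus.integral_inner_laplacian_comm hut hψt]
  have hgrad : ∫ x, ⟪FunctionSpaces.Torus.gradient (p t) x, ψ t x⟫_ℝ = 0 :=
    FunctionSpaces.Torus.integral_inner_gradient_eq_zero_of_isDivFree hψt hpt (hψdiv t)
  have hconv : ∫ x, ⟪FunctionSpaces.Torus.convect (u t) (u t) x, ψ t x⟫_ℝ =
      -∫ x, ⟪u t x, FunctionSpaces.Torus.convect (u t) (ψ t) x⟫_ℝ :=
    FunctionSpaces.Torus.integral_inner_convect_eq_neg hut (h.divFree t ht) hut hψt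
  rw [integral_add i12 i3, integral_add i1 i2]
  simp only [hE'_def]
  simp_rw [hslice, inner_sub_left]
  rw [integral_add i1 iLGC, integral_sub iLG iC, integral_sub iL iG, hlap, hgrad, hconv]
  ring

end Weak

/-! ## The tested local energy equality on the open strip -/

section Energy

variable {T ν : ℝ} {u : ℝ → UnitAddTorus d → EuclideanSpace ℝ d} {p : ℝ → UnitAddTorus d → ℝ}

/-- A continuous-on-`(0,T)` slice functional vanishing off a compact `[a,b] ⊂ (0,T)` is
integrable on `(0,T)`. [folklore] -/
theorem integrableOn_Ioo_of_continuousOn_of_eq_zero {f : ℝ → ℝ} {a b : ℝ}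
    (hIS : Icc a b ⊆ Ioo 0 T) (hf : ContinuousOn f (Ioo 0 T))
    (h0 : ∀ t ∈ Ioo 0 T \ Icc a b, f t = 0) : IntegrableOn f (Ioo 0 T) volume :=
  ((hf.mono hIS).integrableOn_compact isCompact_Icc).of_forall_sdiff_eq_zero measurableSet_Ioo h0

omit [Fintype d] [DecidableEq d] in
/-- The integral over `(0,T)` of the derivative of a slice functional that vanishes at the ends
of a compact `[a,b] ⊂ (0,T)` and whose derivative vanishes off `[a,b]` is zero (fundamental
theorem of calculus on `[a,b]`). [folklore] -/
theorem integral_Ioo_deriv_eq_zero {G G' : ℝ → ℝ} {a b : ℝ} (hab : a ≤ b)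
    (hIS : Icc a b ⊆ Ioo 0 T) (hG : ∀ t ∈ Ioo 0 T, HasDerivWithinAt G (G' t) (Ioo 0 T) t)
    (hG'c : ContinuousOn G' (Ioo 0 T)) (hGa : G a = 0) (hGb : G b = 0)
    (h0 : ∀ t ∈ Ioo 0 T \ Icc a b, G' t = 0) : ∫ t in Ioo 0 T, G' t = 0 := by
  have hFTC : ∫ t in Icc a b, G' t = 0 := by
    rw [integral_Icc_eq_integral_Ioc, ← intervalIntegral.integral_of_le hab,
      intervalIntegral.integral_eq_sub_of_hasDerivAt_of_le hab
        (fun t ht => ((hG t (hIS ht)).continuousWithinAt).mono hIS)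
        (fun t ht => (hG t (hIS (Ioo_subset_Icc_self ht))).hasDerivAt
          (mem_of_superset (Icc_mem_nhds ht.1 ht.2) hIS))
        ((hG'c.mono ((uIcc_of_le hab).subset.trans hIS)).intervalIntegrable),
      hGb, hGa, sub_zero]
  rw [setIntegral_eq_of_subset_of_forall_sdiff_eq_zero measurableSet_Ioo hIS h0, hFTC]

/-- **The tested local energy equality for classical solutions on the open strip, with any
distributional pressure.** Let `(u, p)` be a classical solution of the unforced Navier–Stokes
system with viscosity `ν` on `T^d × (0,T)`, and let `q` be any pressure field making `(u, q)`
a distributional solution on `T^d × (0,T)` (`Torus.IsDistributionalNSSolutionOn T ν 0 u q`; in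
particular `u ∈ L²`, `q ∈ L¹`). Then for every smooth `ψ` compactly supported in
`(0,T) × T^d`,
`∫₀ᵀ∫ [½|u|²∂ₜψ + (½|u|² + q)⟪u,∇ψ⟫ + ½ν|u|²Δψ] = ν ∫₀ᵀ∫ ψ ∑ᵢ ‖∂ᵢu‖²`
(Duchon–Robert 2000, Prop. 1, (6) with `D(u) = 0`: the local energy equality of regular
solutions; Caffarelli–Kohn–Nirenberg 1982, (2.5) with equality). Proof: the distributional
momentum equation of `(u, q)` tested with `Ψ = ψu` (`isSpaceTimeTestIoo_smul_of_isSmoothSpaceTimeOn`) reads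
`∫∫ [⟪u,∂ₜΨ⟫ + ⟪u,(u·∇)Ψ⟫ + ν⟪u,ΔΨ⟫ + q div Ψ] = 0`; slice-wise
`⟪u,∂ₜΨ⟫ = ½∂ₜ(ψ|u|²) + ½|u|²∂ₜψ`, `∫⟪u,(u·∇)Ψ⟫ = ½∫|u|²⟪u,∇ψ⟫`
(`integral_inner_convect_smul_self`), `∫⟪u,ΔΨ⟫ = ½∫|u|²Δψ - ∫ψ∑‖∂ᵢu‖²`
(`integral_inner_laplacian_smul_self`), `div Ψ = ⟪u,∇ψ⟫` (`divergence_smul`, `div u = 0`),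
and `∫₀ᵀ ∂ₜ∫ ψ|u|² = 0` (`integral_Ioo_deriv_eq_zero`). [cite: DuchonRobert2000, Prop. 1 and (6)] -/
theorem _root_.Literature.Analysis.FunctionSpaces.Torus.IsClassicalNSSolutionOn.energyEq_of_isDistributional
    (h : FunctionSpaces.Torus.IsClassicalNSSolutionOn (Ioo 0 T) ν 0 u p)
    {q : ℝ → UnitAddTorus d → ℝ} (hq : IsDistributionalNSSolutionOn T ν 0 u q)
    {ψ : ℝ → UnitAddTorus d → ℝ} (hψ : FunctionSpaces.Torus.IsSpaceTimeTestIoo T ψ) :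
    ∫ t in Ioo 0 T, ∫ x, (2⁻¹ * ‖u t x‖ ^ 2 * FunctionSpaces.Torus.timeDeriv ψ t x +
        (2⁻¹ * ‖u t x‖ ^ 2 + q t x) * ⟪u t x, FunctionSpaces.Torus.gradient (ψ t) x⟫_ℝ +
        2⁻¹ * ν * ‖u t x‖ ^ 2 * FunctionSpaces.Torus.laplacian (ψ t) x) =
      ν * ∫ t in Ioo 0 T, ∫ x, ψ t x * ∑ i, ‖FunctionSpaces.Torus.partialDeriv i (u t) x‖ ^ 2 := by
  -- degenerate time intervals
  rcases le_or_gt T 0 with hT | hT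
  · simp [Ioo_eq_empty (not_lt.2 hT), Measure.restrict_empty, integral_zero_measure]
  obtain ⟨a, b, ha, hab, hbT, hψa, hψb⟩ := exists_support_Icc hψ hT
  obtain ⟨⟨hψs, -, -, -⟩, -⟩ := id hψ
  set S : Set ℝ := Ioo 0 T with hS_def
  have hU : UniqueDiffOn ℝ S := uniqueDiffOn_Ioo 0 T
  have hIS : Icc a b ⊆ S := fun t ht => ⟨ha.trans_le ht.1, ht.2.trans_lt hbT⟩
  have hu : FunctionSpaces.Torus.IsSmoothSpaceTimeOn S u := h.smooth_velocity
  have hψS : FunctionSpaces.Torus.IsSmoothSpaceTimeOn S ψ := hψs.contDiffOn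
  set μT := (volume.restrict S).prod (volume : Measure (UnitAddTorus d)) with hμT
  -- derived smooth space–time fields on the strip
  have hn2 : FunctionSpaces.Torus.IsSmoothSpaceTimeOn S (fun t x => ‖u t x‖ ^ 2) := by
    change ContDiffOn ℝ _ (fun z => ‖FunctionSpaces.Torus.stLift u z‖ ^ 2) _
    exact hu.norm_sq ℝ
  have hdt : FunctionSpaces.Torus.IsSmoothSpaceTimeOn S (FunctionSpaces.Torus.timeDeriv ψ) :=
    hψ.1.timeDeriv.isSmoothSpaceTimeOn S
  have hgr : FunctionSpaces.Torus.IsSmoothSpaceTimeOn S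
      (fun t x => ⟪u t x, FunctionSpaces.Torus.gradient (ψ t) x⟫_ℝ) :=
    hu.inner (hψS.gradient hU)
  have hlp : FunctionSpaces.Torus.IsSmoothSpaceTimeOn S
      (fun t x => FunctionSpaces.Torus.laplacian (ψ t) x) := hψS.laplacian hU
  have hWf : FunctionSpaces.Torus.IsSmoothSpaceTimeOn S
      (fun t x => ψ t x * ∑ i, ‖FunctionSpaces.Torus.partialDeriv i (u t) x‖ ^ 2) := by
    refine hψS.mul (FunctionSpaces.Torus.IsSmoothSpaceTimeOn.sum fun i _ => ?_)
    change ContDiffOn ℝ _ (fun z => ‖FunctionSpaces.Torus.stLift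
      (fun t x => FunctionSpaces.Torus.partialDeriv i (u t) x) z‖ ^ 2) _
    exact (hu.partialDeriv hU i).norm_sq ℝ
  have hg : FunctionSpaces.Torus.IsSmoothSpaceTimeOn S (fun t x => ψ t x * ‖u t x‖ ^ 2) :=
    hψS.mul hn2
  have hconst : ∀ c : ℝ, FunctionSpaces.Torus.IsSmoothSpaceTimeOn S
      (fun (_ : ℝ) (_ : UnitAddTorus d) => c) := fun c => contDiffOn_const
  have hθ : FunctionSpaces.Torus.IsSmoothSpaceTimeOn S (fun t x =>
      2⁻¹ * ‖u t x‖ ^ 2 * FunctionSpaces.Torus.timeDeriv ψ t x +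
        2⁻¹ * ‖u t x‖ ^ 2 * ⟪u t x, FunctionSpaces.Torus.gradient (ψ t) x⟫_ℝ +
        2⁻¹ * ν * ‖u t x‖ ^ 2 * FunctionSpaces.Torus.laplacian (ψ t) x) :=
    ((((hconst 2⁻¹).mul hn2).mul hdt).add (((hconst 2⁻¹).mul hn2).mul hgr)).add
      (((hconst (2⁻¹ * ν)).mul hn2).mul hlp)
  -- the slice functionals
  set W : ℝ → ℝ := fun t => ∫ x, ψ t x * ∑ i, ‖FunctionSpaces.Torus.partialDeriv i (u t) x‖ ^ 2
    with hW_def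
  set G : ℝ → ℝ := fun t => ∫ x, ψ t x * ‖u t x‖ ^ 2 with hG_def
  set Gd : ℝ → ℝ := fun t =>
    ∫ x, FunctionSpaces.Torus.timeDerivWithin S (fun t x => ψ t x * ‖u t x‖ ^ 2) t x with hGd_def
  set Ts : ℝ → ℝ := fun t => ∫ x, (2⁻¹ * ‖u t x‖ ^ 2 * FunctionSpaces.Torus.timeDeriv ψ t x +
      2⁻¹ * ‖u t x‖ ^ 2 * ⟪u t x, FunctionSpaces.Torus.gradient (ψ t) x⟫_ℝ +
      2⁻¹ * ν * ‖u t x‖ ^ 2 * FunctionSpaces.Torus.laplacian (ψ t) x) with hTs_def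
  set Q : ℝ → ℝ := fun t => ∫ x, q t x * ⟪u t x, FunctionSpaces.Torus.gradient (ψ t) x⟫_ℝ
    with hQ_def
  -- vanishing of the `ψ`-derived slices off `[a, b]`
  have hψ0 : ∀ t ∈ S \ Icc a b, ψ t = 0 := by
    intro t ht
    rcases not_and_or.1 (fun h => ht.2 ⟨h.1, h.2⟩) with h1 | h2
    · exact hψa t (not_le.1 h1).le
    · exact hψb t (not_le.1 h2).le
  have hdt0 : ∀ t ∈ S \ Icc a b, ∀ x, FunctionSpaces.Torus.timeDeriv ψ t x = 0 := by
    intro t ht x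
    rcases not_and_or.1 (fun h => ht.2 ⟨h.1, h.2⟩) with h1 | h2
    · exact timeDeriv_eq_zero_of_lt hψa (not_le.1 h1) x
    · exact timeDeriv_eq_zero_of_gt hψb (not_le.1 h2) x
  have hgr0 : ∀ t ∈ S \ Icc a b, ∀ x, FunctionSpaces.Torus.gradient (ψ t) x = 0 := by
    intro t ht x
    rw [hψ0 t ht]
    exact torusGradient_zero x
  have hlp0 : ∀ t ∈ S \ Icc a b, ∀ x, FunctionSpaces.Torus.laplacian (ψ t) x = 0 := by
    intro t ht x
    rw [hψ0 t ht]
    exact torusLaplacian_zero x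
  -- integrability on `S` of `W`, `Ts`, `Gd` (continuous on `S`, zero off `[a, b]`)
  have hWi : IntegrableOn W S volume := by
    refine integrableOn_Ioo_of_continuousOn_of_eq_zero hIS (hWf.continuousOn_integral (convex_Ioo 0 T))
      fun t ht => ?_
    simp only [hW_def, hψ0 t ht, Pi.zero_apply, zero_mul, integral_zero]
  have hTsi : IntegrableOn Ts S volume := by
    refine integrableOn_Ioo_of_continuousOn_of_eq_zero hIS (hθ.continuousOn_integral (convex_Ioo 0 T))
      fun t ht => ?_
    simp only [hTs_def, hdt0 t ht, hgr0 t ht, hlp0 t ht, inner_zero_right, mul_zero, add_zero,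
      integral_zero]
  have hGd0 : ∀ t ∈ S \ Icc a b, Gd t = 0 := by
    intro t ht
    have hev : ∀ x, (fun τ => ψ τ x * ‖u τ x‖ ^ 2) =ᶠ[𝓝 t] fun _ => (0 : ℝ) := by
      intro x
      rcases not_and_or.1 (fun h => ht.2 ⟨h.1, h.2⟩) with h1 | h2
      · filter_upwards [Iio_mem_nhds (not_le.1 h1)] with τ hτ
        rw [hψa τ hτ.le, Pi.zero_apply, zero_mul]
      · filter_upwards [Ioi_mem_nhds (not_le.1 h2)] with τ hτ
        rw [hψb τ hτ.le, Pi.zero_apply, zero_mul]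
    simp only [hGd_def]
    rw [show (fun x => FunctionSpaces.Torus.timeDerivWithin S (fun t x => ψ t x * ‖u t x‖ ^ 2) t x) =
        fun _ => (0 : ℝ) from funext fun x => timeDerivWithin_eq_zero_of_eventuallyEq x (hev x),
      integral_zero]
  have hGdc : ContinuousOn Gd S := hg.continuousOn_integral_timeDerivWithin hU
  have hGdi : IntegrableOn Gd S volume := integrableOn_Ioo_of_continuousOn_of_eq_zero hIS hGdc hGd0
  -- `∫_S Gd = 0`
  have hGd_int : ∫ t in S, Gd t = 0 := by
    refine integral_Ioo_deriv_eq_zero hab hIS (fun t ht => hg.hasDerivWithinAt_integral (convex_Ioo 0 T) ht)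
      hGdc ?_ ?_ hGd0
    · simp only [hψa a le_rfl, Pi.zero_apply, zero_mul, integral_zero]
    · simp only [hψb b le_rfl, Pi.zero_apply, zero_mul, integral_zero]
  -- the pressure piece: `q ⟪u, ∇ψ⟫` is integrable on `S × T^d`
  have hqm : AEStronglyMeasurable (uncurry q) μT := aestronglyMeasurable_uncurry_prod hq.2.2.1
  have hqint : Integrable (uncurry q) μT := by
    refine ⟨hqm, ?_⟩
    have hfin : ∫⁻ z, ‖q z.1 z.2‖ₑ ∂μT < ⊤ := by
      rw [← lintegral_Ioo_lintegral_eq_lintegral_prod (g := fun t x => ‖q t x‖ₑ) hqm.enorm]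
      exact hq.2.2.2.1
    exact hfin
  have hbm : AEStronglyMeasurable (uncurry fun t x => ⟪u t x, FunctionSpaces.Torus.gradient (ψ t) x⟫_ℝ) μT :=
    aestronglyMeasurable_uncurry_prod (hgr.aestronglyMeasurable_stLift measurableSet_Ioo Subset.rfl)
  obtain ⟨Cu, hCu⟩ := hu.exists_norm_le_of_isCompact isCompact_Icc hIS
  obtain ⟨Cg, hCg⟩ := ((hψ.1.isSmoothSpaceTimeOn univ).gradient uniqueDiffOn_univ).exists_norm_le_of_isCompact
    isCompact_Icc (subset_univ (Icc a b))
  have hbound : ∀ᵐ z ∂μT, ‖(uncurry fun t x => ⟪u t x, FunctionSpaces.Torus.gradient (ψ t) x⟫_ℝ) z‖ ≤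
      |Cu| * |Cg| := by
    have hS_ae : ∀ᵐ z ∂μT, z.1 ∈ S :=
      (Measure.quasiMeasurePreserving_fst (μ := volume.restrict S) (ν := volume)).ae
        (ae_restrict_mem measurableSet_Ioo)
    filter_upwards [hS_ae] with z hz
    simp only [uncurry]
    by_cases hzI : z.1 ∈ Icc a b
    · calc ‖⟪u z.1 z.2, FunctionSpaces.Torus.gradient (ψ z.1) z.2⟫_ℝ‖
          ≤ ‖u z.1 z.2‖ * ‖FunctionSpaces.Torus.gradient (ψ z.1) z.2‖ := norm_inner_le_norm _ _
        _ ≤ |Cu| * |Cg| := mul_le_mul ((hCu z.1 hzI z.2).trans (le_abs_self _))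
            ((hCg z.1 hzI z.2).trans (le_abs_self _)) (norm_nonneg _) (abs_nonneg _)
    · rw [hgr0 z.1 ⟨hz, hzI⟩ z.2, inner_zero_right, norm_zero]
      positivity
  have hQb : Integrable (fun z : ℝ × UnitAddTorus d =>
      q z.1 z.2 * ⟪u z.1 z.2, FunctionSpaces.Torus.gradient (ψ z.1) z.2⟫_ℝ) μT :=
    hqint.mul_bdd hbm hbound
  have hQi : Integrable Q (volume.restrict S) := hQb.integral_prod_left
  have hQslice : ∀ᵐ t ∂(volume.restrict S), Integrable (fun x =>
      q t x * ⟪u t x, FunctionSpaces.Torus.gradient (ψ t) x⟫_ℝ) volume := hQb.prod_right_ae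
  -- the test field `Ψ = ψ u` and the distributional momentum equation tested with it
  set Ψ : ℝ → UnitAddTorus d → EuclideanSpace ℝ d := fun t x => ψ t x • u t x with hΨ_def
  have hΨ : FunctionSpaces.Torus.IsSpaceTimeTestIoo T Ψ := isSpaceTimeTestIoo_smul_of_isSmoothSpaceTimeOn hu hψ
  have hD := hq.2.2.2.2.2 Ψ hΨ
  simp only [Pi.zero_apply, inner_zero_left, add_zero] at hD
  -- the slice identity, for a.e. `t ∈ S`
  have hslice : ∀ᵐ t ∂(volume.restrict S),
      (∫ x, (⟪u t x, FunctionSpaces.Torus.timeDeriv Ψ t x⟫_ℝ +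
        ⟪u t x, FunctionSpaces.Torus.convect (u t) (Ψ t) x⟫_ℝ +
        ν * ⟪u t x, FunctionSpaces.Torus.laplacian (Ψ t) x⟫_ℝ +
        q t x * FunctionSpaces.Torus.divergence (Ψ t) x)) =
      (Ts t + Q t) + 2⁻¹ * Gd t - ν * W t := by
    filter_upwards [hQslice, ae_restrict_mem measurableSet_Ioo] with t hqt ht
    have hut : FunctionSpaces.Torus.IsSmooth (u t) := hu.isSmooth_slice ht
    have hψt : FunctionSpaces.Torus.IsSmooth (ψ t) := hψS.isSmooth_slice ht
    have hu1 : FunctionSpaces.Torus.IsContDiff 1 (u t) := hut.isContDiff (by simp)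
    have hψ1 : FunctionSpaces.Torus.IsContDiff 1 (ψ t) := hψt.isContDiff (by simp)
    have hS_nhds : S ∈ 𝓝 t := isOpen_Ioo.mem_nhds ht
    -- pointwise time derivatives
    have hpt : ∀ x, ⟪u t x, FunctionSpaces.Torus.timeDeriv Ψ t x⟫_ℝ =
        2⁻¹ * FunctionSpaces.Torus.timeDerivWithin S (fun t x => ψ t x * ‖u t x‖ ^ 2) t x +
          2⁻¹ * ‖u t x‖ ^ 2 * FunctionSpaces.Torus.timeDeriv ψ t x := by
      intro x
      have h1 : HasDerivAt (fun τ => u τ x) (FunctionSpaces.Torus.timeDerivWithin S u t x) t :=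
        (hu.hasDerivWithinAt_slice ht x).hasDerivAt hS_nhds
      have h2 : HasDerivAt (fun τ => ψ τ x) (FunctionSpaces.Torus.timeDeriv ψ t x) t := by
        obtain ⟨y, rfl⟩ := FunctionSpaces.Torus.proj_surjective x
        have hd : Differentiable ℝ (fun τ : ℝ => FunctionSpaces.Torus.stLift ψ (τ, y)) :=
          (hψs.differentiable (by simp)).comp (differentiable_id.prodMk (differentiable_const y))
        exact (hd t).hasDerivAt
      have hΨ' : FunctionSpaces.Torus.timeDeriv Ψ t x =
          ψ t x • FunctionSpaces.Torus.timeDerivWithin S u t x +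
            FunctionSpaces.Torus.timeDeriv ψ t x • u t x := (h2.smul h1).deriv
      have hg' : FunctionSpaces.Torus.timeDerivWithin S (fun t x => ψ t x * ‖u t x‖ ^ 2) t x =
          FunctionSpaces.Torus.timeDeriv ψ t x * ‖u t x‖ ^ 2 +
            ψ t x * (2 * ⟪u t x, FunctionSpaces.Torus.timeDerivWithin S u t x⟫_ℝ) := by
        change derivWithin (fun τ => ψ τ x * ‖u τ x‖ ^ 2) S t = _
        rw [derivWithin_of_mem_nhds hS_nhds]
        exact (h2.mul h1.norm_sq).deriv
      rw [hΨ', hg', inner_add_right, inner_smul_right, inner_smul_right, real_inner_self_eq_norm_sq]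
      ring
    have hdivΨ : ∀ x, FunctionSpaces.Torus.divergence (Ψ t) x =
        ⟪u t x, FunctionSpaces.Torus.gradient (ψ t) x⟫_ℝ := by
      intro x
      change FunctionSpaces.Torus.divergence (fun y => ψ t y • u t y) x = _
      rw [divergence_smul hψ1 hu1, h.divFree t ht x, mul_zero, add_zero]
    -- integrable pieces
    have hgds : FunctionSpaces.Torus.IsSmooth
        (FunctionSpaces.Torus.timeDerivWithin S (fun t x => ψ t x * ‖u t x‖ ^ 2) t) :=
      hg.isSmooth_timeDerivWithin hU ht
    have hΨt : FunctionSpaces.Torus.IsSmooth (Ψ t) := hψt.smul' hut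
    have hs2 : FunctionSpaces.Torus.IsSmooth (fun x => ‖u t x‖ ^ 2 * FunctionSpaces.Torus.timeDeriv ψ t x) :=
      (hn2.isSmooth_slice ht).mul (hdt.isSmooth_slice ht)
    have hs3 : FunctionSpaces.Torus.IsSmooth
        (fun x => ‖u t x‖ ^ 2 * ⟪u t x, FunctionSpaces.Torus.gradient (ψ t) x⟫_ℝ) :=
      (hn2.isSmooth_slice ht).mul (hgr.isSmooth_slice ht)
    have hs4 : FunctionSpaces.Torus.IsSmooth
        (fun x => ‖u t x‖ ^ 2 * FunctionSpaces.Torus.laplacian (ψ t) x) :=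
      (hn2.isSmooth_slice ht).mul (hlp.isSmooth_slice ht)
    have iA : Integrable (fun x => 2⁻¹ * FunctionSpaces.Torus.timeDerivWithin S
        (fun t x => ψ t x * ‖u t x‖ ^ 2) t x) volume := hgds.integrable.const_mul _
    have iB : Integrable (fun x => 2⁻¹ * (‖u t x‖ ^ 2 * FunctionSpaces.Torus.timeDeriv ψ t x)) volume :=
      hs2.integrable.const_mul _
    have iC : Integrable (fun x => ⟪u t x, FunctionSpaces.Torus.convect (u t) (Ψ t) x⟫_ℝ) volume :=
      (hut.inner (hut.convect hΨt)).integrable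
    have iD : Integrable (fun x => ν * ⟪u t x, FunctionSpaces.Torus.laplacian (Ψ t) x⟫_ℝ) volume :=
      (hut.inner hΨt.laplacian).integrable.const_mul _
    have iB' : Integrable (fun x => 2⁻¹ * (‖u t x‖ ^ 2 *
        ⟪u t x, FunctionSpaces.Torus.gradient (ψ t) x⟫_ℝ)) volume := hs3.integrable.const_mul _
    have iD' : Integrable (fun x => (2⁻¹ * ν) * (‖u t x‖ ^ 2 *
        FunctionSpaces.Torus.laplacian (ψ t) x)) volume := hs4.integrable.const_mul _
    -- the two integrations by parts on the torus
    have hconv : ∫ x, ⟪u t x, FunctionSpaces.Torus.convect (u t) (Ψ t) x⟫_ℝ =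
        2⁻¹ * ∫ x, ‖u t x‖ ^ 2 * ⟪u t x, FunctionSpaces.Torus.gradient (ψ t) x⟫_ℝ :=
      integral_inner_convect_smul_self hut (h.divFree t ht) hψt
    have hlap : ∫ x, ⟪u t x, FunctionSpaces.Torus.laplacian (Ψ t) x⟫_ℝ =
        2⁻¹ * (∫ x, ‖u t x‖ ^ 2 * FunctionSpaces.Torus.laplacian (ψ t) x) -
          ∫ x, ψ t x * ∑ i, ‖FunctionSpaces.Torus.partialDeriv i (u t) x‖ ^ 2 :=
      integral_inner_laplacian_smul_self hut hψt
    -- rewrite the tested integrand pointwise and split the integral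
    have hF : ∀ x, ⟪u t x, FunctionSpaces.Torus.timeDeriv Ψ t x⟫_ℝ +
        ⟪u t x, FunctionSpaces.Torus.convect (u t) (Ψ t) x⟫_ℝ +
        ν * ⟪u t x, FunctionSpaces.Torus.laplacian (Ψ t) x⟫_ℝ +
        q t x * FunctionSpaces.Torus.divergence (Ψ t) x =
        2⁻¹ * FunctionSpaces.Torus.timeDerivWithin S (fun t x => ψ t x * ‖u t x‖ ^ 2) t x +
          2⁻¹ * (‖u t x‖ ^ 2 * FunctionSpaces.Torus.timeDeriv ψ t x) +
          ⟪u t x, FunctionSpaces.Torus.convect (u t) (Ψ t) x⟫_ℝ +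
          ν * ⟪u t x, FunctionSpaces.Torus.laplacian (Ψ t) x⟫_ℝ +
          q t x * ⟪u t x, FunctionSpaces.Torus.gradient (ψ t) x⟫_ℝ := by
      intro x
      rw [hpt x, hdivΨ x]
      ring
    have hTsx : ∀ x, 2⁻¹ * ‖u t x‖ ^ 2 * FunctionSpaces.Torus.timeDeriv ψ t x +
        2⁻¹ * ‖u t x‖ ^ 2 * ⟪u t x, FunctionSpaces.Torus.gradient (ψ t) x⟫_ℝ +
        2⁻¹ * ν * ‖u t x‖ ^ 2 * FunctionSpaces.Torus.laplacian (ψ t) x =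
        2⁻¹ * (‖u t x‖ ^ 2 * FunctionSpaces.Torus.timeDeriv ψ t x) +
          2⁻¹ * (‖u t x‖ ^ 2 * ⟪u t x, FunctionSpaces.Torus.gradient (ψ t) x⟫_ℝ) +
          (2⁻¹ * ν) * (‖u t x‖ ^ 2 * FunctionSpaces.Torus.laplacian (ψ t) x) := fun x => by ring
    have iBB' : Integrable (fun x => 2⁻¹ * (‖u t x‖ ^ 2 * FunctionSpaces.Torus.timeDeriv ψ t x) +
        2⁻¹ * (‖u t x‖ ^ 2 * ⟪u t x, FunctionSpaces.Torus.gradient (ψ t) x⟫_ℝ)) volume := iB.add iB'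
    have hTs : Ts t = 2⁻¹ * (∫ x, ‖u t x‖ ^ 2 * FunctionSpaces.Torus.timeDeriv ψ t x) +
        2⁻¹ * (∫ x, ‖u t x‖ ^ 2 * ⟪u t x, FunctionSpaces.Torus.gradient (ψ t) x⟫_ℝ) +
        (2⁻¹ * ν) * ∫ x, ‖u t x‖ ^ 2 * FunctionSpaces.Torus.laplacian (ψ t) x := by
      simp only [hTs_def]
      rw [integral_congr_ae (ae_of_all _ hTsx), integral_add iBB' iD',
        integral_add iB iB', integral_const_mul, integral_const_mul, integral_const_mul]
    have iAB : Integrable (fun x =>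
        2⁻¹ * FunctionSpaces.Torus.timeDerivWithin S (fun t x => ψ t x * ‖u t x‖ ^ 2) t x +
          2⁻¹ * (‖u t x‖ ^ 2 * FunctionSpaces.Torus.timeDeriv ψ t x)) volume := iA.add iB
    have iABC : Integrable (fun x =>
        2⁻¹ * FunctionSpaces.Torus.timeDerivWithin S (fun t x => ψ t x * ‖u t x‖ ^ 2) t x +
          2⁻¹ * (‖u t x‖ ^ 2 * FunctionSpaces.Torus.timeDeriv ψ t x) +
          ⟪u t x, FunctionSpaces.Torus.convect (u t) (Ψ t) x⟫_ℝ) volume := iAB.add iC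
    have iABCD : Integrable (fun x =>
        2⁻¹ * FunctionSpaces.Torus.timeDerivWithin S (fun t x => ψ t x * ‖u t x‖ ^ 2) t x +
          2⁻¹ * (‖u t x‖ ^ 2 * FunctionSpaces.Torus.timeDeriv ψ t x) +
          ⟪u t x, FunctionSpaces.Torus.convect (u t) (Ψ t) x⟫_ℝ +
          ν * ⟪u t x, FunctionSpaces.Torus.laplacian (Ψ t) x⟫_ℝ) volume := iABC.add iD
    rw [integral_congr_ae (ae_of_all _ hF), integral_add iABCD hqt,
      integral_add iABC iD, integral_add iAB iC, integral_add iA iB,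
      integral_const_mul, integral_const_mul, integral_const_mul, hconv, hlap, hTs]
    simp only [hGd_def, hW_def, hQ_def]
    ring
  -- the target integrand, slice-wise
  have hTg : ∀ᵐ t ∂(volume.restrict S),
      (∫ x, (2⁻¹ * ‖u t x‖ ^ 2 * FunctionSpaces.Torus.timeDeriv ψ t x +
        (2⁻¹ * ‖u t x‖ ^ 2 + q t x) * ⟪u t x, FunctionSpaces.Torus.gradient (ψ t) x⟫_ℝ +
        2⁻¹ * ν * ‖u t x‖ ^ 2 * FunctionSpaces.Torus.laplacian (ψ t) x)) = Ts t + Q t := by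
    filter_upwards [hQslice, ae_restrict_mem measurableSet_Ioo] with t hqt ht
    have hpt : ∀ x, 2⁻¹ * ‖u t x‖ ^ 2 * FunctionSpaces.Torus.timeDeriv ψ t x +
        (2⁻¹ * ‖u t x‖ ^ 2 + q t x) * ⟪u t x, FunctionSpaces.Torus.gradient (ψ t) x⟫_ℝ +
        2⁻¹ * ν * ‖u t x‖ ^ 2 * FunctionSpaces.Torus.laplacian (ψ t) x =
        (2⁻¹ * ‖u t x‖ ^ 2 * FunctionSpaces.Torus.timeDeriv ψ t x +
          2⁻¹ * ‖u t x‖ ^ 2 * ⟪u t x, FunctionSpaces.Torus.gradient (ψ t) x⟫_ℝ +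
          2⁻¹ * ν * ‖u t x‖ ^ 2 * FunctionSpaces.Torus.laplacian (ψ t) x) +
          q t x * ⟪u t x, FunctionSpaces.Torus.gradient (ψ t) x⟫_ℝ := fun x => by ring
    rw [integral_congr_ae (ae_of_all _ hpt), integral_add (hθ.isSmooth_slice ht).integrable hqt]
  -- integrate in time
  have jTQ : Integrable (fun t => Ts t + Q t) (volume.restrict S) := hTsi.integrable.add hQi
  have jG : Integrable (fun t => 2⁻¹ * Gd t) (volume.restrict S) := hGdi.integrable.const_mul _
  have jW : Integrable (fun t => ν * W t) (volume.restrict S) := hWi.integrable.const_mul _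
  have jTQG : Integrable (fun t => Ts t + Q t + 2⁻¹ * Gd t) (volume.restrict S) := jTQ.add jG
  have hint1 : (∫ t in S, ∫ x, (⟪u t x, FunctionSpaces.Torus.timeDeriv Ψ t x⟫_ℝ +
      ⟪u t x, FunctionSpaces.Torus.convect (u t) (Ψ t) x⟫_ℝ +
      ν * ⟪u t x, FunctionSpaces.Torus.laplacian (Ψ t) x⟫_ℝ +
      q t x * FunctionSpaces.Torus.divergence (Ψ t) x)) =
      (∫ t in S, (Ts t + Q t)) + 2⁻¹ * (∫ t in S, Gd t) - ν * ∫ t in S, W t := by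
    rw [integral_congr_ae hslice, integral_sub jTQG jW, integral_add jTQ jG, integral_const_mul,
      integral_const_mul]
  rw [hint1, hGd_int, mul_zero, add_zero, sub_eq_zero] at hD
  rw [integral_congr_ae hTg, hD]

end Energy

end Literature.Analysis.FluidPDE.Torus

end
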